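import Literature.NumberTheory.LFunctions.CubeRootTwoField
import Mathlib.NumberTheory.NumberField.ClassNumber
import HarnessLib

/-!
# `ℤ[2^{1/3}]` is a principal ideal domain (class number one of `ℚ(2^{1/3})`)

Support for the decomposition of **parity.S18** along D. R. Heath-Brown, *Primes represented by
`x³ + 2y³`*, Acta Math. 186 (2001): throughout §§11–13 (the proof of Lemma 3.10) Heath-Brown
"replace[s] `R` and `S` by their generators `α` and `β`" (p. 68), i.e. uses that every ideal of
`𝓞_K = ℤ[2^{1/3}]`, `K = ℚ(2^{1/3})`, is principal ("the class number of `K` is 1", p. 3).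

We PROVE this classical fact (`instIsPrincipalIdealRing`) by the Minkowski bound, in the form
Mathlib provides (`RingOfIntegers.isPrincipalIdealRing_of_isPrincipal_of_norm_le_of_isPrime`):

* `integralPB`, `integralPB_gen`, `integralPB_dim` — the integral power basis `1, θ, θ²` of
  `𝓞_K = ℤ[θ]` (from the tree's `adjoin_θint_eq_top`);
* `discr_eq : NumberField.discr K = −108` (transfer of the tree's `discr_pbθ` along the integral
  power basis, as Mathlib does for cyclotomic fields);
* `nrComplexPlaces_le_one`, `minkowskiBound_lt_three` — `(4/π)^{r₂} · (3!/3³) · √108 < 3`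
  (`r₂ ≤ 1` as `r₁ + 2 r₂ = 3`; `√108 < 10.4`, `π > 3.14`);
* `θint_pow_three`, `absNorm_span_θint : N((θ)) = 2`, `span_θint_isMaximal`,
  `eq_span_θint_of_isPrime_of_absNorm_eq_two` — the only prime of norm `2` is `(θ) = (2^{1/3})`
  (`2 = θ³`);
* `instIsPrincipalIdealRing : IsPrincipalIdealRing (𝓞 K)` and the corollary
  `exists_eq_span_singleton` (every ideal is `(β)`).

## References

* D. R. Heath-Brown, *Primes represented by `x³ + 2y³`*, Acta Math. 186 (2001), 1–84, p. 3 and §11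
  p. 68. [cite: HeathBrownActa2001, §11 p. 68]
* D. A. Marcus, *Number Fields*, Springer (1977), Ch. 5, Thm. 37 and the discussion following it
  (Minkowski bound; `ℚ(2^{1/3})` has class number one). [folklore]

## Mathlib search

Used: `RingOfIntegers.isPrincipalIdealRing_of_isPrincipal_of_norm_le_of_isPrime` (Minkowski),
`NumberField.discr_eq_discr`, `Algebra.discr_localizationLocalization`, `Algebra.discr_reindex`,
`PowerBasis.ofAdjoinEqTop'`, `NumberField.InfinitePlace.card_add_two_mul_card_eq_rank`,
`Real.pi_gt_d2`. Tree: `CubeRootTwoField` (`K`, `θ`, `θint`, `pbθ`, `discr_pbθ`, `minpoly_θint`,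
`adjoin_θint_eq_top`, `norm_θ`). No class-number-one result for a cubic field was in the tree
(searched `IsPrincipalIdealRing (𝓞`, `classNumber`).
-/

noncomputable section

open Polynomial NumberField Algebra Module

open scoped nonZeroDivisors Real

namespace Literature.NumberTheory.LFunctions.CubeRootTwoField

/-! ### The integral power basis `1, θ, θ²` and the discriminant `−108` -/

/-- `θint` is integral over `ℤ` (as is every element of `𝓞_K`). [folklore] -/
theorem isIntegral_θint : IsIntegral ℤ (θint : 𝓞 K) := RingOfIntegers.isIntegral θint

/-- **The integral power basis** of `𝓞_K = ℤ[2^{1/3}]` generated by `θ = 2^{1/3}`.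
[cite: HeathBrownActa2001, §4 p. 21] -/
def integralPB : PowerBasis ℤ (𝓞 K) :=
  PowerBasis.ofAdjoinEqTop' isIntegral_θint adjoin_θint_eq_top

/-- The generator of the integral power basis is `θ`. [folklore] -/
@[simp] theorem integralPB_gen : integralPB.gen = θint :=
  PowerBasis.ofAdjoinEqTop'_gen _ _

/-- The integral power basis has three elements. [folklore] -/
@[simp] theorem integralPB_dim : integralPB.dim = 3 := by
  rw [integralPB, PowerBasis.ofAdjoinEqTop'_dim, minpoly_θint, cubicPoly_natDegree]

/-- **`disc ℚ(2^{1/3}) = −108`**: the absolute discriminant of `K` is that of the power basis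
`1, θ, θ²`, which is an integral basis. [folklore] -/
theorem discr_eq : NumberField.discr K = -108 := by
  classical
  apply (algebraMap ℤ ℚ).injective_int
  rw [← NumberField.discr_eq_discr _ integralPB.basis,
    ← Algebra.discr_localizationLocalization ℤ ℤ⁰ K]
  have hdim : integralPB.dim = pbθ.dim := by rw [integralPB_dim, pbθ_dim]
  have key : Algebra.discr ℚ ⇑(integralPB.basis.localizationLocalization ℚ ℤ⁰ K) =
      Algebra.discr ℚ ⇑pbθ.basis := by
    rw [← Algebra.discr_reindex ℚ (integralPB.basis.localizationLocalization ℚ ℤ⁰ K)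
      (finCongr hdim)]
    congr 1
    ext i
    simp only [Function.comp_apply, Module.Basis.localizationLocalization_apply,
      PowerBasis.coe_basis, integralPB_gen, pbθ_gen, finCongr_symm, finCongr_apply,
      Fin.val_cast, map_pow]
    rfl
  rw [key, discr_pbθ]
  simp

/-! ### The Minkowski bound of `K` is `< 3` -/

/-- `K` has at most one complex place (`r₁ + 2 r₂ = 3`). [folklore] -/
theorem nrComplexPlaces_le_one : InfinitePlace.nrComplexPlaces K ≤ 1 := by
  have h := InfinitePlace.card_add_two_mul_card_eq_rank K
  rw [finrank_K] at h
  omega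

/-- `√108 < 10.4`. [folklore] -/
theorem sqrt_108_lt : Real.sqrt 108 < 10.4 := by
  rw [Real.sqrt_lt' (by norm_num)]
  norm_num

/-- **The Minkowski bound of `ℚ(2^{1/3})` is less than `3`**:
`(4/π)^{r₂} · 3!/3³ · √|−108| < 3`. [folklore] -/
theorem minkowskiBound_lt_three :
    (4 / π) ^ InfinitePlace.nrComplexPlaces K *
        ((finrank ℚ K).factorial / (finrank ℚ K : ℝ) ^ finrank ℚ K *
          Real.sqrt |(NumberField.discr K : ℝ)|) < 3 := by
  rw [finrank_K, discr_eq]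
  have hπ : 3.14 < π := Real.pi_gt_d2
  have hπ0 : 0 < π := Real.pi_pos
  have h4π : 1 ≤ 4 / π := by
    rw [le_div_iff₀ hπ0]; linarith [Real.pi_le_four]
  have hpow : (4 / π) ^ InfinitePlace.nrComplexPlaces K ≤ 4 / π := by
    calc (4 / π) ^ InfinitePlace.nrComplexPlaces K ≤ (4 / π) ^ 1 :=
          pow_le_pow_right₀ h4π nrComplexPlaces_le_one
      _ = 4 / π := pow_one _
  have hfac : ((Nat.factorial 3 : ℕ) : ℝ) = 6 := by norm_num [Nat.factorial]
  have habs : |((-108 : ℤ) : ℝ)| = 108 := by norm_num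
  rw [hfac, habs]
  have hs := sqrt_108_lt
  have hs0 : 0 ≤ Real.sqrt 108 := Real.sqrt_nonneg _
  have hB : (6 : ℝ) / (3 : ℝ) ^ 3 * Real.sqrt 108 ≤ 6 / 27 * 10.4 := by
    norm_num
    nlinarith
  have hB0 : 0 ≤ (6 : ℝ) / (3 : ℝ) ^ 3 * Real.sqrt 108 := by positivity
  calc (4 / π) ^ InfinitePlace.nrComplexPlaces K * ((6 : ℝ) / (3 : ℝ) ^ 3 * Real.sqrt 108)
      ≤ 4 / π * (6 / 27 * 10.4) := mul_le_mul hpow hB hB0 (by positivity)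
    _ < 3 := by
        rw [div_mul_eq_mul_div, div_lt_iff₀ hπ0]
        nlinarith

/-! ### The prime above `2` -/

/-- `θ³ = 2` in `𝓞_K`. [folklore] -/
theorem θint_pow_three : (θint : 𝓞 K) ^ 3 = 2 := by
  apply RingOfIntegers.coe_injective
  simp [θ_pow_three, map_ofNat]

/-- `N_{K/ℚ}(θ) = 2` for `θ ∈ 𝓞_K`. [folklore] -/
theorem norm_θint : Algebra.norm ℤ (θint : 𝓞 K) = 2 := by
  have h := Algebra.coe_norm_int (θint : 𝓞 K)
  rw [coe_θint, norm_θ] at h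
  exact_mod_cast h

/-- `N((θ)) = 2`. [folklore] -/
theorem absNorm_span_θint : Ideal.absNorm (Ideal.span {(θint : 𝓞 K)}) = 2 := by
  rw [Ideal.absNorm_span_singleton, norm_θint]
  rfl

/-- `(θ)` is a maximal ideal (its norm `2` is prime). [folklore] -/
theorem span_θint_isMaximal : (Ideal.span {(θint : 𝓞 K)}).IsMaximal := by
  have hprime : (Ideal.span {(θint : 𝓞 K)}).IsPrime :=
    Ideal.isPrime_of_irreducible_absNorm (by rw [absNorm_span_θint]; exact Nat.prime_two)
  refine hprime.isMaximal ?_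
  intro h
  have := absNorm_span_θint
  rw [h, Ideal.absNorm_bot] at this
  exact absurd this (by norm_num)

/-- **The only prime ideal of norm `2` is `(θ)`**: a prime `I` with `N(I) = 2` contains `2 = θ³`,
hence `θ`, hence the maximal ideal `(θ)`. [folklore] -/
theorem eq_span_θint_of_isPrime_of_absNorm_eq_two {I : Ideal (𝓞 K)} (hI : I.IsPrime)
    (h2 : Ideal.absNorm I = 2) : I = Ideal.span {(θint : 𝓞 K)} := by
  have hmem2 : ((2 : ℕ) : 𝓞 K) ∈ I := by rw [← h2]; exact Ideal.absNorm_mem I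
  have hθ3 : (θint : 𝓞 K) ^ 3 ∈ I := by
    rw [θint_pow_three]; exact_mod_cast hmem2
  have hθ : (θint : 𝓞 K) ∈ I := hI.mem_of_pow_mem 3 hθ3
  have hle : Ideal.span {(θint : 𝓞 K)} ≤ I := (Ideal.span_singleton_le_iff_mem I).mpr hθ
  exact (span_θint_isMaximal.eq_of_le hI.ne_top hle).symm

/-! ### Class number one -/

/-- **`𝓞_K = ℤ[2^{1/3}]` is a principal ideal domain** ("the class number of `K = ℚ(2^{1/3})` is
one", used by Heath-Brown to pass from ideals `R, S` to generators `α, β`, p. 68): by the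
Minkowski bound `< 3` it suffices that the primes of norm `≤ 2` are principal, and the only such
prime is `(2^{1/3})`. [cite: HeathBrownActa2001, §11 p. 68] -/
instance instIsPrincipalIdealRing : IsPrincipalIdealRing (𝓞 K) := by
  refine RingOfIntegers.isPrincipalIdealRing_of_isPrincipal_of_norm_le_of_isPrime ?_
  intro I hI hIM
  have hlt : (Ideal.absNorm (I : Ideal (𝓞 K)) : ℝ) < 3 := lt_of_le_of_lt hIM minkowskiBound_lt_three
  have hlt' : Ideal.absNorm (I : Ideal (𝓞 K)) < 3 := by exact_mod_cast hlt
  have hne : Ideal.absNorm (I : Ideal (𝓞 K)) ≠ 0 :=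
    Ideal.absNorm_ne_zero_of_nonZeroDivisors I
  interval_cases h : Ideal.absNorm (I : Ideal (𝓞 K))
  · exact absurd rfl hne
  · rw [Ideal.absNorm_eq_one_iff] at h
    rw [h]
    exact ⟨⟨1, by simp⟩⟩
  · rw [eq_span_θint_of_isPrime_of_absNorm_eq_two hI h]
    exact ⟨⟨θint, rfl⟩⟩

/-- Every ideal of `𝓞_K` is principal: `I = (β)` for some `β ∈ ℤ[2^{1/3}]`.
[cite: HeathBrownActa2001, §11 p. 68] -/
theorem exists_eq_span_singleton (I : Ideal (𝓞 K)) : ∃ β : 𝓞 K, I = Ideal.span {β} :=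
  (IsPrincipalIdealRing.principal I).principal

end Literature.NumberTheory.LFunctions.CubeRootTwoField

end
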